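import Summits.BirchSwinnertonDyer.Rank1Residual.GaloisImage.KolyvaginSystemOfEulerSystemAdditiveThree
import Summits.BirchSwinnertonDyer.Rank1Residual.GaloisImage.TorsionPadicIntCoefficients
import Summits.BirchSwinnertonDyer.Rank1Residual.GaloisImage.TorsionPadicIntCoefficientsLocal
import Literature.NumberTheory.EllipticCurves.TateModuleProjSurjectiveProofs
import HarnessLib

/-!
# THEOREM D for `𝓕_can` on `E[3^k·3]` in the coefficient reading `T′ = E[3^{k+1}]_{ℤ_3}` — the two
# N11 row classes at the place `3` with every coefficient binder discharged
# (cell `b2b-bsdres`, n1011 p11 GEN 10; row T-DER, THEOREM D file D6b = D5b read through GZ-2)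

HONEST FRAMING (cell `b2b-bsdres`, run/shared/lean/b2b/bsd-rank1-residual/, verbatim in every
file): the goal of the cell is to DELETE the COMBINATION-SHAPED residual classes of the
Birch–Swinnerton-Dyer formula for ALL analytic-rank `≤ 1` elliptic curves over `ℚ` — "full BSD
formula for every rank `≤ 1` curve in class `C`" assembled STRICTLY from published theorems — so
that the rank-`≤ 1` remainder becomes exactly the CONSTRUCTION-SHAPED classes, which are TYPED
(missing-input `Prop`s), NOT attempted. This is not "finishing BSD". Team n1011: research route on
the CONSTRUCTION-SHAPED class X4 / §I N11 (route-1 PORT, (P-DER), clause C1/C0); TOOL theorem.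
HONEST LIMITS: NO Euler system is asserted to exist (hypothesis `hc`; the PORT binds Kato's by the
§48.4 socket); clause C1 is met with `κ′ = κ`; the value clauses C2/C3 are NOT here; DISPLAYED
row-class certificates: `hbad` (`E(ℚ_w)[3] = 0` at the bad `w ≠ 3`) and EITHER `htors₃`
(`E(ℚ₃)[3] = 0`) with the reduction maps `rd` (F12's) OR additive reduction at `3` with the depth
datum `k + 2 ≤ m`, primes of level `m + 1`, and the reduction map `r : E[3^m·3] → E[3^k·3]`
(T-DER-BP's).  No definition, no named fact, no `sorry`; the `ℤ_3`-module structures on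
`E[3^{k+1}]`, `E[3^{m+1}]` are GZ-2's reducible `def` activated by `letI` INSIDE the statements.

## What

`exists_isKolyvaginSystem_propagatedSelmerStructure_three_of_torsion_eq_zero_torsionCoeff` and
`exists_isKolyvaginSystem_propagatedSelmerStructure_three_of_hasAdditiveReductionAt_torsionCoeff`
= D5b's two ENDs with `T′ = TorsionCoeff.torsionRepPadicInt W 3 (k+1)` (and
`T″ = torsionRepPadicInt W 3 (m+1)` for the deeper family), `red = TorsionCoeff.tateModuleRed`,
`e`/`einv` the inclusions along `TorsionCoeff.geomTorsion_pow_succ_eq`, `hcomp = rfl`, `hred` by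
`proj_surjective_of_isAlgClosed_holds`, `hM` by `TorsionCoeff.pow_smul_eq_zero`.  Output as in D6
`exists_isKolyvaginSystem_propagatedSelmerStructure_torsionCoeff`.
References: B. Mazur, K. Rubin, Mem. AMS 799 (2004), Thm. 3.2.4, App. A (Lemma A.1, Prop. A.2);
K. Rubin, *Euler Systems* (2000), §4.4; J. Silverman, *AEC*, III.§7.
-/

noncomputable section

open CategoryTheory Function Finset Polynomial Field IsDedekindDomain
open scoped NumberField Classical ContRepresentation
open Literature.NumberTheory.GaloisRepresentations Literature.NumberTheory.EllipticCurves
open Literature.NumberTheory.GaloisRepresentations.DiscreteGaloisModule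
open Literature.NumberTheory.GaloisCohomology
open Summit.BirchSwinnertonDyer.Rank1Residual.GaloisImage.CoeffTransport
open Summit.BirchSwinnertonDyer.Rank1Residual.GaloisImage.CyclotomicLevel
open Summit.BirchSwinnertonDyer.Rank1Residual.GaloisImage.TorsionCoeff
open Rat.HeightOneSpectrum WeierstrassCurve

universe u

namespace Summit.BirchSwinnertonDyer.Rank1Residual.GaloisImage.Derivative.Rat

variable (W : WeierstrassCurve ℚ) [W.IsElliptic] [W.IsGloballyMinimal]
variable [Module.Free ℤ_[3] (W.tateModule 3)] [Module.Finite ℤ_[3] (W.tateModule 3)]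
  [ContinuousSMul ℤ_[3] (W.tateModule 3)]

/-- Local notation: `T∞ = T_3 E` as a continuous `G_ℚ`-representation. -/
local notation3 "T∞" => WeierstrassCurve.tateGaloisRep W 3 (W.continuous_galoisRepTate_holds 3)

variable (S : Set (HeightOneSpectrum (𝓞 ℚ)))

/-- Local notation: `𝓛` = the cyclotomic Euler-system levels `ℚ(μ_{3^{n+1}}, μ_r)`, `r ∩ S = ∅`. -/
local notation3 "𝓛" => cyclotomicLevelsRat 3 S

/-- Local notation: `𝐃ℤ⟦X, U, τ⟧ ℓ = ∑_{j < ℓ−1} j·(τ_ℓ)_*^j` on `H¹(U, X)` (`ℤ`-linear). -/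
local notation3 (prettyPrint := false) "𝐃ℤ⟦" X ", " U ", " τ "⟧" =>
  fun ℓ : HeightOneSpectrum (𝓞 ℚ) =>
  ∑ j ∈ Finset.range (((primesEquiv ℓ : Nat.Primes) : ℕ) - 1),
    (j : Module.End ℤ (continuousCohomology 1 (subgroupRep X U))) *
      (conjMap X U ((τ : HeightOneSpectrum (𝓞 ℚ) → absoluteGaloisGroup ℚ) ℓ) 1).hom.toLinearMap ^ j

/-- Local notation: the level-`j` reduction `red_j : T_3E ⟶ E[3^j]_{ℤ_3}` (GZ-2). -/
local notation3 "𝐫𝐞𝐝⟦" j "⟧" => tateModuleRed W 3 (W.continuous_galoisRepTate_holds 3) j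

/-- **THEOREM D for `𝓕_can` on `E[3^k·3]`, coefficients `E[3^{k+1}]_{ℤ_3}`, rows with
`E(ℚ₃)[3] = 0`** (D5b (a) read through GZ-2; binders = the PORT's + `htors₃`, `rd`/`hrd`).
[cite: MazurRubin2004, App. A, Lemma A.1 (p. 79) and Thm. 3.2.4] [cite: Sakamoto2024, Def. 4.1 (p. 926)] -/
theorem exists_isKolyvaginSystem_propagatedSelmerStructure_three_of_torsion_eq_zero_torsionCoeff
    {c : ∀ (i : ℕ) (r : (𝓛).Ideals), H1 T∞ ((𝓛).level i r.1)}
    (hc : IsEulerSystem 𝓛 T∞ 3 c) (k : ℕ) (hirr : W.HasIrreducibleModPGaloisRep 3)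
    (D : KolyvaginDatum (W.torsionGaloisModule (((3 : ℕ) : ℤ) ^ k * ((3 : ℕ) : ℤ))))
    (hT : D.transverse = cyclotomicTransverse (W.torsionGaloisModule (((3 : ℕ) : ℤ) ^ k * ((3 : ℕ) : ℤ))))
    {η : (ℓ : HeightOneSpectrum (𝓞 ℚ)) → (ZMod (Ideal.absNorm ℓ.asIdeal))ˣ}
    (hD : D.HasCanonicalComparison (3 ^ (k + 1)) η)
    (hPr : D.primes ⊆ (𝓛).primes)
    (hKol : ∀ ℓ ∈ D.primes, Kato.IsKolyvaginPrime W 3 (k + 1) ((primesEquiv ℓ : Nat.Primes) : ℕ))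
    (hbad : ∀ w : HeightOneSpectrum (𝓞 ℚ), ¬ W.HasGoodReductionAt w →
      ((primesEquiv w : Nat.Primes) : ℕ) ≠ 3 →
        ∀ P : (W.baseChange (w.adicCompletion ℚ)).toAffine.Point, 3 • P = 0 → P = 0)
    (htors₃ : ∀ v : HeightOneSpectrum (𝓞 ℚ), ((3 : ℕ) : 𝓞 ℚ) ∈ v.asIdeal →
      ∀ P : (W.baseChange (v.adicCompletion ℚ)).toAffine.Point, 3 • P = 0 → P = 0)
    (rd : ∀ j : ℕ, (W.torsionGaloisModule (((3 : ℕ) : ℤ) ^ (j + 1) * ((3 : ℕ) : ℤ))).toContRepresentation →ⁱL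
      (W.torsionGaloisModule (((3 : ℕ) : ℤ) ^ j * ((3 : ℕ) : ℤ))).toContRepresentation)
    (hrd : ∀ (j : ℕ) (x : geomTorsion W (((3 : ℕ) : ℤ) ^ (j + 1) * ((3 : ℕ) : ℤ))),
      ((rd j x : geomTorsion W (((3 : ℕ) : ℤ) ^ j * ((3 : ℕ) : ℤ))) : geomPoints W) =
        ((3 : ℕ) : ℤ) • (x : geomPoints W)) :
    letI := TorsionCoeff.torsionBy.padicIntModule 3 (k + 1) (WeierstrassCurve.geomPoints W)
    ∃ (σ : HeightOneSpectrum (𝓞 ℚ) → absoluteGaloisGroup ℚ)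
      (Φ : ∀ r : Finset (HeightOneSpectrum (𝓞 ℚ)),
        continuousCohomology 1 (subgroupRep (torsionRepPadicInt W 3 (k + 1)).toTopRep ((𝓛).level ⊥ r)) →+
          continuousCohomology 1 (subgroupRep
            (W.torsionGaloisModule (((3 : ℕ) : ℤ) ^ k * ((3 : ℕ) : ℤ))).toTopRep ((𝓛).level ⊥ r)))
      (comm : ∀ r : Finset (HeightOneSpectrum (𝓞 ℚ)),
        ((r : Finset _) : Set (HeightOneSpectrum (𝓞 ℚ))).Pairwise fun a b =>
          Commute (𝐃ℤ⟦(W.torsionGaloisModule (((3 : ℕ) : ℤ) ^ k * ((3 : ℕ) : ℤ))).toTopRep, ((𝓛).level ⊥ r), σ⟧ a)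
            (𝐃ℤ⟦(W.torsionGaloisModule (((3 : ℕ) : ℤ) ^ k * ((3 : ℕ) : ℤ))).toTopRep, ((𝓛).level ⊥ r), σ⟧ b))
      (κ : Finset (HeightOneSpectrum (𝓞 ℚ)) →
        galoisCohomology (W.torsionGaloisModule (((3 : ℕ) : ℤ) ^ k * ((3 : ℕ) : ℤ))) 1),
      (∀ ℓ, σ ℓ ∈ (adicCompletionPrime ℚ ℓ).inertia (absoluteGaloisGroup ℚ)) ∧
      (∀ ℓ, modNCyclotomicCharacter ℚ (Ideal.absNorm ℓ.asIdeal) (σ ℓ) = η ℓ) ∧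
      (∀ r, ∀ (φ : contOneCocycles (subgroupRep (torsionRepPadicInt W 3 (k + 1)).toTopRep ((𝓛).level ⊥ r)))
        (ψ : contOneCocycles (subgroupRep
          (W.torsionGaloisModule (((3 : ℕ) : ℤ) ^ k * ((3 : ℕ) : ℤ))).toTopRep ((𝓛).level ⊥ r))),
        (∀ g, ψ.1 g = AddSubgroup.inclusion (geomTorsion_pow_succ_eq W 3 k).le (φ.1 g)) →
          Φ r (oneCocycleClass _ φ) = oneCocycleClass _ ψ) ∧
      D.IsKolyvaginSystem (propagatedSelmerStructure W 3 k) κ ∧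
      (∀ r : Finset (HeightOneSpectrum (𝓞 ℚ)), ¬ (↑r : Set _) ⊆ D.primes → κ r = 0) ∧
      ∀ (r : Finset (HeightOneSpectrum (𝓞 ℚ))) (hr : (↑r : Set _) ⊆ D.primes),
        resSubgroup (W.torsionGaloisModule (((3 : ℕ) : ℤ) ^ k * ((3 : ℕ) : ℤ))).toTopRep ((𝓛).level ⊥ r) 1
            (κ r) =
          (r.noncommProd 𝐃ℤ⟦(W.torsionGaloisModule (((3 : ℕ) : ℤ) ^ k * ((3 : ℕ) : ℤ))).toTopRep,
              ((𝓛).level ⊥ r), σ⟧ (comm r))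
            (Φ r (ContinuousCohomology.map (ContinuousMonoidHom.id _)
              (X := subgroupRep T∞.toTopRep ((𝓛).level ⊥ r))
              (Y := subgroupRep (torsionRepPadicInt W 3 (k + 1)).toTopRep ((𝓛).level ⊥ r))
              ((TopRep.resFunctor ((𝓛).level ⊥ r).subtype).map 𝐫𝐞𝐝⟦k + 1⟧) 1
              (c ⊥ ⟨r, fun _ hq => hPr (hr (Finset.mem_coe.2 hq))⟩))) := by
  letI := TorsionCoeff.torsionBy.padicIntModule 3 (k + 1) (WeierstrassCurve.geomPoints W)
  have hred : Function.Surjective (𝐫𝐞𝐝⟦k + 1⟧).hom := by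
    intro y
    obtain ⟨a, ha⟩ := W.proj_surjective_of_isAlgClosed_holds 3 (k + 1) y.2
    exact ⟨a, Subtype.ext ha⟩
  exact exists_isKolyvaginSystem_propagatedSelmerStructure_three_of_torsion_eq_zero W S hc 𝐫𝐞𝐝⟦k + 1⟧
    hred (fun m => pow_smul_eq_zero 3 (k + 1) _ m)
    (AddSubgroup.inclusion (geomTorsion_pow_succ_eq W 3 k).le : _ →+ _) continuous_of_discreteTopology
    (fun _ _ => rfl) (AddSubgroup.inclusion (geomTorsion_pow_succ_eq W 3 k).ge : _ →+ _)
    continuous_of_discreteTopology (fun x => Subtype.ext rfl) (fun y => Subtype.ext rfl) hirr D hT hD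
    hPr hKol hbad htors₃ rd hrd

/-- **THEOREM D for `𝓕_can` on `E[3^k·3]`, coefficients `E[3^{k+1}]_{ℤ_3}` and `E[3^{m+1}]_{ℤ_3}`,
ADDITIVE rows at `3`** (D5b (b) read through GZ-2; binders = the PORT's + `hadd`, the depth datum
`hkm`, primes of level `m + 1`, and T-DER-BP's reduction map `r`/`hr`).
[cite: MazurRubin2004, App. A Prop. A.2 and Thm. 3.2.4] [cite: Sakamoto2024, Def. 4.1 (p. 926)] -/
theorem exists_isKolyvaginSystem_propagatedSelmerStructure_three_of_hasAdditiveReductionAt_torsionCoeff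
    {c : ∀ (i : ℕ) (r : (𝓛).Ideals), H1 T∞ ((𝓛).level i r.1)}
    (hc : IsEulerSystem 𝓛 T∞ 3 c) {k m : ℕ} (hkm : k + 2 ≤ m)
    (r : (W.torsionGaloisModule (((3 : ℕ) : ℤ) ^ m * ((3 : ℕ) : ℤ))).toContRepresentation →ⁱL
      (W.torsionGaloisModule (((3 : ℕ) : ℤ) ^ k * ((3 : ℕ) : ℤ))).toContRepresentation)
    (hr : ∀ x : geomTorsion W (((3 : ℕ) : ℤ) ^ m * ((3 : ℕ) : ℤ)),
      ((r x : geomTorsion W (((3 : ℕ) : ℤ) ^ k * ((3 : ℕ) : ℤ))) : geomPoints W) =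
        (((3 : ℕ) : ℤ) ^ (m - k)) • (x : geomPoints W))
    (hirr : W.HasIrreducibleModPGaloisRep 3)
    (hadd : ∀ v : HeightOneSpectrum (𝓞 ℚ), ((primesEquiv v : Nat.Primes) : ℕ) = 3 →
      W.HasAdditiveReductionAt v)
    (D : KolyvaginDatum (W.torsionGaloisModule (((3 : ℕ) : ℤ) ^ k * ((3 : ℕ) : ℤ))))
    (hT : D.transverse = cyclotomicTransverse (W.torsionGaloisModule (((3 : ℕ) : ℤ) ^ k * ((3 : ℕ) : ℤ))))
    {η : (ℓ : HeightOneSpectrum (𝓞 ℚ)) → (ZMod (Ideal.absNorm ℓ.asIdeal))ˣ}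
    (hD : D.HasCanonicalComparison (3 ^ (k + 1)) η)
    (hPr : D.primes ⊆ (𝓛).primes)
    (hKol : ∀ ℓ ∈ D.primes, Kato.IsKolyvaginPrime W 3 (m + 1) ((primesEquiv ℓ : Nat.Primes) : ℕ))
    (hbad : ∀ w : HeightOneSpectrum (𝓞 ℚ), ¬ W.HasGoodReductionAt w →
      ((primesEquiv w : Nat.Primes) : ℕ) ≠ 3 →
        ∀ P : (W.baseChange (w.adicCompletion ℚ)).toAffine.Point, 3 • P = 0 → P = 0) :
    letI := TorsionCoeff.torsionBy.padicIntModule 3 (k + 1) (WeierstrassCurve.geomPoints W)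
    ∃ (σ : HeightOneSpectrum (𝓞 ℚ) → absoluteGaloisGroup ℚ)
      (Φ : ∀ r : Finset (HeightOneSpectrum (𝓞 ℚ)),
        continuousCohomology 1 (subgroupRep (torsionRepPadicInt W 3 (k + 1)).toTopRep ((𝓛).level ⊥ r)) →+
          continuousCohomology 1 (subgroupRep
            (W.torsionGaloisModule (((3 : ℕ) : ℤ) ^ k * ((3 : ℕ) : ℤ))).toTopRep ((𝓛).level ⊥ r)))
      (comm : ∀ r : Finset (HeightOneSpectrum (𝓞 ℚ)),
        ((r : Finset _) : Set (HeightOneSpectrum (𝓞 ℚ))).Pairwise fun a b =>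
          Commute (𝐃ℤ⟦(W.torsionGaloisModule (((3 : ℕ) : ℤ) ^ k * ((3 : ℕ) : ℤ))).toTopRep, ((𝓛).level ⊥ r), σ⟧ a)
            (𝐃ℤ⟦(W.torsionGaloisModule (((3 : ℕ) : ℤ) ^ k * ((3 : ℕ) : ℤ))).toTopRep, ((𝓛).level ⊥ r), σ⟧ b))
      (κ : Finset (HeightOneSpectrum (𝓞 ℚ)) →
        galoisCohomology (W.torsionGaloisModule (((3 : ℕ) : ℤ) ^ k * ((3 : ℕ) : ℤ))) 1),
      (∀ ℓ, σ ℓ ∈ (adicCompletionPrime ℚ ℓ).inertia (absoluteGaloisGroup ℚ)) ∧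
      (∀ ℓ, modNCyclotomicCharacter ℚ (Ideal.absNorm ℓ.asIdeal) (σ ℓ) = η ℓ) ∧
      (∀ r, ∀ (φ : contOneCocycles (subgroupRep (torsionRepPadicInt W 3 (k + 1)).toTopRep ((𝓛).level ⊥ r)))
        (ψ : contOneCocycles (subgroupRep
          (W.torsionGaloisModule (((3 : ℕ) : ℤ) ^ k * ((3 : ℕ) : ℤ))).toTopRep ((𝓛).level ⊥ r))),
        (∀ g, ψ.1 g = AddSubgroup.inclusion (geomTorsion_pow_succ_eq W 3 k).le (φ.1 g)) →
          Φ r (oneCocycleClass _ φ) = oneCocycleClass _ ψ) ∧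
      D.IsKolyvaginSystem (propagatedSelmerStructure W 3 k) κ ∧
      (∀ r : Finset (HeightOneSpectrum (𝓞 ℚ)), ¬ (↑r : Set _) ⊆ D.primes → κ r = 0) ∧
      ∀ (r : Finset (HeightOneSpectrum (𝓞 ℚ))) (hr : (↑r : Set _) ⊆ D.primes),
        resSubgroup (W.torsionGaloisModule (((3 : ℕ) : ℤ) ^ k * ((3 : ℕ) : ℤ))).toTopRep ((𝓛).level ⊥ r) 1
            (κ r) =
          (r.noncommProd 𝐃ℤ⟦(W.torsionGaloisModule (((3 : ℕ) : ℤ) ^ k * ((3 : ℕ) : ℤ))).toTopRep,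
              ((𝓛).level ⊥ r), σ⟧ (comm r))
            (Φ r (ContinuousCohomology.map (ContinuousMonoidHom.id _)
              (X := subgroupRep T∞.toTopRep ((𝓛).level ⊥ r))
              (Y := subgroupRep (torsionRepPadicInt W 3 (k + 1)).toTopRep ((𝓛).level ⊥ r))
              ((TopRep.resFunctor ((𝓛).level ⊥ r).subtype).map 𝐫𝐞𝐝⟦k + 1⟧) 1
              (c ⊥ ⟨r, fun _ hq => hPr (hr (Finset.mem_coe.2 hq))⟩))) := by
  letI := TorsionCoeff.torsionBy.padicIntModule 3 (k + 1) (WeierstrassCurve.geomPoints W)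
  letI := TorsionCoeff.torsionBy.padicIntModule 3 (m + 1) (WeierstrassCurve.geomPoints W)
  have hred : ∀ j : ℕ, Function.Surjective (𝐫𝐞𝐝⟦j⟧).hom := fun j y => by
    obtain ⟨a, ha⟩ := W.proj_surjective_of_isAlgClosed_holds 3 j y.2
    exact ⟨a, Subtype.ext ha⟩
  exact exists_isKolyvaginSystem_propagatedSelmerStructure_three_of_hasAdditiveReductionAt W S hc hkm
    𝐫𝐞𝐝⟦k + 1⟧ (hred (k + 1)) (fun x => pow_smul_eq_zero 3 (k + 1) _ x)
    (AddSubgroup.inclusion (geomTorsion_pow_succ_eq W 3 k).le : _ →+ _) continuous_of_discreteTopology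
    (fun _ _ => rfl) (AddSubgroup.inclusion (geomTorsion_pow_succ_eq W 3 k).ge : _ →+ _)
    continuous_of_discreteTopology (fun x => Subtype.ext rfl) (fun y => Subtype.ext rfl) (fun _ => rfl)
    𝐫𝐞𝐝⟦m + 1⟧ (fun x => pow_smul_eq_zero 3 (m + 1) _ x)
    (AddSubgroup.inclusion (geomTorsion_pow_succ_eq W 3 m).le : _ →+ _) continuous_of_discreteTopology
    (fun _ _ => rfl) (AddSubgroup.inclusion (geomTorsion_pow_succ_eq W 3 m).ge : _ →+ _)
    continuous_of_discreteTopology (fun x => Subtype.ext rfl) (fun y => Subtype.ext rfl) (fun _ => rfl)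
    r hr hirr hadd D hT hD hPr hKol hbad

end Summit.BirchSwinnertonDyer.Rank1Residual.GaloisImage.Derivative.Rat

end
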